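/-
Origin: expansion seat `planner-pub-hodgecm-mc-axioms-1-g14-0`, handover #W232 2026-08-20T15:53:55Z md5 4c51e1e91cae (PKG 8c952c365766 → 4c51e1e91cae; 243 l.; MECHANICAL (iib-R) rewrite v3.1 of the PKG file as it stands (90 token edits; rules R1x2+RX[h₂]x88)) (`HOME/mc/pub-hodgecm-mc-axioms-1-g14/revendor/kit-r55/stage55/HodgeCM/Model/Binders/Real34WedgeSpan.lean`, md5 4c51e1e91cae, 243 lines);
landed by the gen-22 packager (p-g22) in gate run 55 REPLACES the earlier landed copy of `HodgeCM/Model/Binders/Real34WedgeSpan.lean` (seat copy carried the packager Origin header of an earlier run (stripped)).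
-/
/-
Origin: speedrun cell pub-hodgecm, MODEL-CONSTRUCTION sub-cell, unit pub-hodgecm-mc-binder-1-g11 (BINDER PROVER, gen 11; row 15's residual `hwedge`,
K34-PLAN §3 (γ) packaging), seat prover-pub-hodgecm-mc-binder-1-g11-0, 2026-08-20.  Target in PKG: HodgeCM/Model/Binders/Real34WedgeSpan.lean
(NEW additive leaf; imports `Binders/Real34PinsTotalPK` (#38, this lineage) only).  KERNEL ONLY: defs `admWedgeSet` (a `Set`) / `admWedgeSpan` (a submodule), theorems; 0 records of published theorems, nothing cited, 0 `def … : Prop`,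
MODEL-N ±0, E unchanged.  Nothing here is a claim of the manuscripts under adjudication.
-/
import Summits.HodgeConjecture.HodgeCM.Model.Binders.Real34PinsTotalPK

/-!
# Row 15's `hwedge` is MEMBERSHIP IN A SPAN: the submodule of admissible (34) wedge sums

`Gen12PinsP.Real34CensusSide.hwedge` asks, for every inserted printed vector `core.side.ins f φ` of mc-binder-2's (34) census core, for a
`Fin n`-indexed family of `adm₃₄`-admissible situations of lines `2`, `3` with frames `φ₂ i`, `φ₃ i` and coefficients `a i` such that
`ins f φ = Σ i, a i • (tau34 (φ₂ i 0) (φ₃ i 1) − tau34 (φ₂ i 1) (φ₃ i 0))`.  This leaf shows that this `∃ n …`-shape IS membership in the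
ℂ-span of the SINGLE admissible wedges and draws the consequences every producer of `hwedge` will use:

* § 1 `admWedgeSet S₀ hV` — the SINGLE admissible (34) wedges `tau34 (φ₂ 0) (φ₃ 1) − tau34 (φ₂ 1) (φ₃ 0)` of the side
  `S₀ : ThetaAdelicSide V c` in the regime `hV` (one level, two admissible situations with test families in `𝓙`, two frames with their frame
  equations); `admWedgeSpan S₀ hV := span ℂ (admWedgeSet S₀ hV)`; `wedge_mem_admWedgeSpan`;
* § 2 **`exists_wedgeSum_of_mem_admWedgeSpan`**: `Ψ ∈ admWedgeSpan S₀ hV` ⇒ the `hwedge`-body for `Ψ` (Mathlib `Submodule.mem_span_set'` +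
  unpacking the chosen wedges into parallel `Fin n`-families — no dependent concatenation needed), and the converse `mem_admWedgeSpan_of_wedgeSum`;
* § 3 **`forall_mem_of_tprod_mem`**: a linear map out of a `PiTensorProduct` lands in a submodule as soon as it does on pure tensors
  (`PiTensorProduct.span_tprod_eq_top`) — the printed archimedean module `pl.F = ⨂[ℂ] b, (pl.loc b).M` of ANY `FockPlaces` is such a product;
* § 4 at the guarded pins: **`Gen12PinsP.Real34CensusSide.ofSpan core h`** (`h : ∀ f φ, core.side.ins f φ ∈ admWedgeSpan ((SGP …) V c) hV`) and
  **`Gen12PinsP.Real34CensusSide.ofTprod core h`** (`h : ∀ f m, core.side.ins f (tprod ℂ m) ∈ admWedgeSpan …`) — so row 15's residual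
  `hwedge` READS: every transported inserted printed PURE tensor `ins₃₄ f (⊗_b m_b)` is a ℂ-combination of single admissible wedges of `SROG V c`.
  That is the statement the letter algebra ((α) finite part, (β) archimedean letters; mc-binder-2's `ins`/`isoOp` currency) and the supply of
  admissible line-2/3 situations with prescribed frames ((T3)/(T3′); theta-3 / carch-1 currency) must meet; `Submodule.add_mem/smul_mem/sum_mem`
  do the rest.
-/

set_option autoImplicit false

noncomputable section

open MeasureTheory NumberField
open scoped TensorProduct

namespace HodgeCM.Model

open HodgeCM HodgeCM.Universe HodgeCM.Adelic HodgeCM.Model.HypCensus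
open HodgeCM.PerL34 HodgeCM.PerL34.Fock HodgeCM.PerL34.Fock.PrintDict
open Literature.NumberTheory.Weil1964
open Literature.NumberTheory.Automorphic (piSchwartzBruhat)
open Literature.NumberTheory.GelbartRogawski1991.UnitaryDualPair
open Literature.AlgebraicGeometry.HodgeTheory
open Literature.NumberTheory.Automorphic.PicardCM
open Literature.NumberTheory.Transcendental (Arapura2012_Cor_15_4_6)
open HodgeCM.Model.ThetaSpace
open HodgeCM.Model.ArchSideTerm

section Generic

variable (hHD : exists_isReal_hodgeModel) (hI : hodgePQ_independent_of_hodgeModel)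
  (h₁ : BallQuotientUniformised)  (h₃ : CMAbelianVarietyRealised)

variable {L : CMField} {ι₁ : L →+* ℂ} {V : HermSpace3 L ι₁} {c : SeesawCtx L} (S₀ : ThetaAdelicSide V c) (hV : IsAnisotropic L V.Hm)

/-! ## 1. The single admissible (34) wedges and their span -/

/-- **The set of single admissible (34) wedges of the side `S₀`** in the regime `hV`: the wedge tensors
`tau34 (φ₂ 0) (φ₃ 1) − tau34 (φ₂ 1) (φ₃ 0)` of the frames `φ₂ φ₃ : Fin 2 → 𝒮(𝔸^3)` of `adm₃₄`-admissible `K`-type situations `Sit₂`, `Sit₃`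
of lines `2`, `3` at a common level `Γ`, with theta-equivariant test families `j₂ ∈ Sit₂.𝓙`, `j₃ ∈ Sit₃.𝓙` and the frame equations
`toThetaTop (φₖ a') = jₖ (ιₖ e_{a'})` (the summand of `hwedge`; a `Set`, not a record — record elaboration of these dependent field types
exceeds the default `whnf` budget). -/
def admWedgeSet : Set (piSchwartzBruhat (↥(maximalRealSubfield L)) (Fin 6)) :=
  {Ψ | ∃ (Γ : Level V)
      (Sit₂ : KTypeSituation ((thetaSpaceInputIn hHD hI h₁ h₃ S₀ hV).P 2) ((thetaSpaceInputIn hHD hI h₁ h₃ S₀ hV).ιinf Γ)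
        ((thetaSpaceInputIn hHD hI h₁ h₃ S₀ hV).Δ Γ) (thetaSpaceInputIn hHD hI h₁ h₃ S₀ hV).κ₁ (thetaSpaceInputIn hHD hI h₁ h₃ S₀ hV).τ₁)
      (j₂ : {j : Sit₂.E →ₗ[ℂ] ((thetaSpaceInputIn hHD hI h₁ h₃ S₀ hV).P 2).weilDatum.ThetaTop //
        ((thetaSpaceInputIn hHD hI h₁ h₃ S₀ hV).P 2).kernelDatum.IsThetaEquivariant Sit₂.κ Sit₂.σ j})
      (Sit₃ : KTypeSituation ((thetaSpaceInputIn hHD hI h₁ h₃ S₀ hV).P 3) ((thetaSpaceInputIn hHD hI h₁ h₃ S₀ hV).ιinf Γ)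
        ((thetaSpaceInputIn hHD hI h₁ h₃ S₀ hV).Δ Γ) (thetaSpaceInputIn hHD hI h₁ h₃ S₀ hV).κ₁ (thetaSpaceInputIn hHD hI h₁ h₃ S₀ hV).τ₁)
      (j₃ : {j : Sit₃.E →ₗ[ℂ] ((thetaSpaceInputIn hHD hI h₁ h₃ S₀ hV).P 3).weilDatum.ThetaTop //
        ((thetaSpaceInputIn hHD hI h₁ h₃ S₀ hV).P 3).kernelDatum.IsThetaEquivariant Sit₃.κ Sit₃.σ j})
      (φ₂ φ₃ : Fin 2 → piSchwartzBruhat (thetaSpaceInputIn hHD hI h₁ h₃ S₀ hV).K (Fin 3)),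
      (adm₃₄ hHD hI h₁ h₃ S₀ hV Γ 2 Sit₂ ∧ j₂ ∈ Sit₂.𝓙 ∧ adm₃₄ hHD hI h₁ h₃ S₀ hV Γ 3 Sit₃ ∧ j₃ ∈ Sit₃.𝓙) ∧
      (∀ a', ((thetaSpaceInputIn hHD hI h₁ h₃ S₀ hV).P 2).weilDatum.toThetaTop (φ₂ a') = j₂.1 (Sit₂.ι (LinearMap.proj a'))) ∧
      (∀ a', ((thetaSpaceInputIn hHD hI h₁ h₃ S₀ hV).P 3).weilDatum.toThetaTop (φ₃ a') = j₃.1 (Sit₃.ι (LinearMap.proj a'))) ∧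
      Ψ = tau34 V c.D (φ₂ 0) (φ₃ 1) - tau34 V c.D (φ₂ 1) (φ₃ 0)}

/-- **the submodule of admissible (34) wedge sums** of the side `S₀` in the regime `hV`. -/
def admWedgeSpan : Submodule ℂ (piSchwartzBruhat (↥(maximalRealSubfield L)) (Fin 6)) :=
  Submodule.span ℂ (admWedgeSet hHD hI h₁ h₃ S₀ hV)

/-- a single admissible wedge lies in the span. -/
theorem wedge_mem_admWedgeSpan (Γ : Level V)
    (Sit₂ : KTypeSituation ((thetaSpaceInputIn hHD hI h₁ h₃ S₀ hV).P 2) ((thetaSpaceInputIn hHD hI h₁ h₃ S₀ hV).ιinf Γ)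
      ((thetaSpaceInputIn hHD hI h₁ h₃ S₀ hV).Δ Γ) (thetaSpaceInputIn hHD hI h₁ h₃ S₀ hV).κ₁ (thetaSpaceInputIn hHD hI h₁ h₃ S₀ hV).τ₁)
    (j₂ : {j : Sit₂.E →ₗ[ℂ] ((thetaSpaceInputIn hHD hI h₁ h₃ S₀ hV).P 2).weilDatum.ThetaTop //
      ((thetaSpaceInputIn hHD hI h₁ h₃ S₀ hV).P 2).kernelDatum.IsThetaEquivariant Sit₂.κ Sit₂.σ j})
    (Sit₃ : KTypeSituation ((thetaSpaceInputIn hHD hI h₁ h₃ S₀ hV).P 3) ((thetaSpaceInputIn hHD hI h₁ h₃ S₀ hV).ιinf Γ)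
      ((thetaSpaceInputIn hHD hI h₁ h₃ S₀ hV).Δ Γ) (thetaSpaceInputIn hHD hI h₁ h₃ S₀ hV).κ₁ (thetaSpaceInputIn hHD hI h₁ h₃ S₀ hV).τ₁)
    (j₃ : {j : Sit₃.E →ₗ[ℂ] ((thetaSpaceInputIn hHD hI h₁ h₃ S₀ hV).P 3).weilDatum.ThetaTop //
      ((thetaSpaceInputIn hHD hI h₁ h₃ S₀ hV).P 3).kernelDatum.IsThetaEquivariant Sit₃.κ Sit₃.σ j})
    (φ₂ φ₃ : Fin 2 → piSchwartzBruhat (thetaSpaceInputIn hHD hI h₁ h₃ S₀ hV).K (Fin 3))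
    (hadm : adm₃₄ hHD hI h₁ h₃ S₀ hV Γ 2 Sit₂ ∧ j₂ ∈ Sit₂.𝓙 ∧ adm₃₄ hHD hI h₁ h₃ S₀ hV Γ 3 Sit₃ ∧ j₃ ∈ Sit₃.𝓙)
    (hfr₂ : ∀ a', ((thetaSpaceInputIn hHD hI h₁ h₃ S₀ hV).P 2).weilDatum.toThetaTop (φ₂ a') = j₂.1 (Sit₂.ι (LinearMap.proj a')))
    (hfr₃ : ∀ a', ((thetaSpaceInputIn hHD hI h₁ h₃ S₀ hV).P 3).weilDatum.toThetaTop (φ₃ a') = j₃.1 (Sit₃.ι (LinearMap.proj a'))) :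
    tau34 V c.D (φ₂ 0) (φ₃ 1) - tau34 V c.D (φ₂ 1) (φ₃ 0) ∈ admWedgeSpan hHD hI h₁ h₃ S₀ hV :=
  Submodule.subset_span ⟨Γ, Sit₂, j₂, Sit₃, j₃, φ₂, φ₃, hadm, hfr₂, hfr₃, rfl⟩

/-! ## 2. Membership in the span is the `hwedge`-body -/

/-- **A member of `admWedgeSpan` is a `Fin n`-indexed admissible wedge sum** — the exact body of `Real34CensusSide.hwedge` (and of #28's
`Real34KTypeDatum.hdec`) for the vector `Ψ`. -/
theorem exists_wedgeSum_of_mem_admWedgeSpan {Ψ : piSchwartzBruhat (↥(maximalRealSubfield L)) (Fin 6)}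
    (hΨ : Ψ ∈ admWedgeSpan hHD hI h₁ h₃ S₀ hV) :
    ∃ (n : ℕ) (Γ' : Fin n → Level V)
      (Sit₂ : ∀ i, KTypeSituation ((thetaSpaceInputIn hHD hI h₁ h₃ S₀ hV).P 2) ((thetaSpaceInputIn hHD hI h₁ h₃ S₀ hV).ιinf (Γ' i))
        ((thetaSpaceInputIn hHD hI h₁ h₃ S₀ hV).Δ (Γ' i)) (thetaSpaceInputIn hHD hI h₁ h₃ S₀ hV).κ₁ (thetaSpaceInputIn hHD hI h₁ h₃ S₀ hV).τ₁)
      (j₂ : ∀ i, {j : (Sit₂ i).E →ₗ[ℂ] ((thetaSpaceInputIn hHD hI h₁ h₃ S₀ hV).P 2).weilDatum.ThetaTop //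
        ((thetaSpaceInputIn hHD hI h₁ h₃ S₀ hV).P 2).kernelDatum.IsThetaEquivariant (Sit₂ i).κ (Sit₂ i).σ j})
      (Sit₃ : ∀ i, KTypeSituation ((thetaSpaceInputIn hHD hI h₁ h₃ S₀ hV).P 3) ((thetaSpaceInputIn hHD hI h₁ h₃ S₀ hV).ιinf (Γ' i))
        ((thetaSpaceInputIn hHD hI h₁ h₃ S₀ hV).Δ (Γ' i)) (thetaSpaceInputIn hHD hI h₁ h₃ S₀ hV).κ₁ (thetaSpaceInputIn hHD hI h₁ h₃ S₀ hV).τ₁)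
      (j₃ : ∀ i, {j : (Sit₃ i).E →ₗ[ℂ] ((thetaSpaceInputIn hHD hI h₁ h₃ S₀ hV).P 3).weilDatum.ThetaTop //
        ((thetaSpaceInputIn hHD hI h₁ h₃ S₀ hV).P 3).kernelDatum.IsThetaEquivariant (Sit₃ i).κ (Sit₃ i).σ j})
      (φ₂ φ₃ : Fin n → Fin 2 → piSchwartzBruhat (thetaSpaceInputIn hHD hI h₁ h₃ S₀ hV).K (Fin 3)) (a : Fin n → ℂ),
      (∀ i, adm₃₄ hHD hI h₁ h₃ S₀ hV (Γ' i) 2 (Sit₂ i) ∧ j₂ i ∈ (Sit₂ i).𝓙 ∧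
        adm₃₄ hHD hI h₁ h₃ S₀ hV (Γ' i) 3 (Sit₃ i) ∧ j₃ i ∈ (Sit₃ i).𝓙) ∧
      (∀ i a', ((thetaSpaceInputIn hHD hI h₁ h₃ S₀ hV).P 2).weilDatum.toThetaTop (φ₂ i a') = (j₂ i).1 ((Sit₂ i).ι (LinearMap.proj a'))) ∧
      (∀ i a', ((thetaSpaceInputIn hHD hI h₁ h₃ S₀ hV).P 3).weilDatum.toThetaTop (φ₃ i a') = (j₃ i).1 ((Sit₃ i).ι (LinearMap.proj a'))) ∧
      Ψ = ∑ i, a i • (tau34 V c.D (φ₂ i 0) (φ₃ i 1) - tau34 V c.D (φ₂ i 1) (φ₃ i 0)) := by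
  obtain ⟨n, f, g, hsum⟩ := Submodule.mem_span_set'.1 hΨ
  -- unpack the chosen single wedges into parallel families
  choose Γ' Sit₂ j₂ Sit₃ j₃ φ₂ φ₃ hadm hfr₂ hfr₃ hval using fun i => (g i).2
  refine ⟨n, Γ', Sit₂, j₂, Sit₃, j₃, φ₂, φ₃, f, hadm, hfr₂, hfr₃, ?_⟩
  rw [← hsum]
  exact Finset.sum_congr rfl fun i _ => by rw [hval i]

/-- Conversely, an admissible wedge sum lies in the span. -/
theorem mem_admWedgeSpan_of_wedgeSum {Ψ : piSchwartzBruhat (↥(maximalRealSubfield L)) (Fin 6)}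
    {n : ℕ} (Γ' : Fin n → Level V)
    (Sit₂ : ∀ i, KTypeSituation ((thetaSpaceInputIn hHD hI h₁ h₃ S₀ hV).P 2) ((thetaSpaceInputIn hHD hI h₁ h₃ S₀ hV).ιinf (Γ' i))
      ((thetaSpaceInputIn hHD hI h₁ h₃ S₀ hV).Δ (Γ' i)) (thetaSpaceInputIn hHD hI h₁ h₃ S₀ hV).κ₁ (thetaSpaceInputIn hHD hI h₁ h₃ S₀ hV).τ₁)
    (j₂ : ∀ i, {j : (Sit₂ i).E →ₗ[ℂ] ((thetaSpaceInputIn hHD hI h₁ h₃ S₀ hV).P 2).weilDatum.ThetaTop //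
      ((thetaSpaceInputIn hHD hI h₁ h₃ S₀ hV).P 2).kernelDatum.IsThetaEquivariant (Sit₂ i).κ (Sit₂ i).σ j})
    (Sit₃ : ∀ i, KTypeSituation ((thetaSpaceInputIn hHD hI h₁ h₃ S₀ hV).P 3) ((thetaSpaceInputIn hHD hI h₁ h₃ S₀ hV).ιinf (Γ' i))
      ((thetaSpaceInputIn hHD hI h₁ h₃ S₀ hV).Δ (Γ' i)) (thetaSpaceInputIn hHD hI h₁ h₃ S₀ hV).κ₁ (thetaSpaceInputIn hHD hI h₁ h₃ S₀ hV).τ₁)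
    (j₃ : ∀ i, {j : (Sit₃ i).E →ₗ[ℂ] ((thetaSpaceInputIn hHD hI h₁ h₃ S₀ hV).P 3).weilDatum.ThetaTop //
      ((thetaSpaceInputIn hHD hI h₁ h₃ S₀ hV).P 3).kernelDatum.IsThetaEquivariant (Sit₃ i).κ (Sit₃ i).σ j})
    (φ₂ φ₃ : Fin n → Fin 2 → piSchwartzBruhat (thetaSpaceInputIn hHD hI h₁ h₃ S₀ hV).K (Fin 3)) (a : Fin n → ℂ)
    (hadm : ∀ i, adm₃₄ hHD hI h₁ h₃ S₀ hV (Γ' i) 2 (Sit₂ i) ∧ j₂ i ∈ (Sit₂ i).𝓙 ∧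
      adm₃₄ hHD hI h₁ h₃ S₀ hV (Γ' i) 3 (Sit₃ i) ∧ j₃ i ∈ (Sit₃ i).𝓙)
    (hfr₂ : ∀ i a', ((thetaSpaceInputIn hHD hI h₁ h₃ S₀ hV).P 2).weilDatum.toThetaTop (φ₂ i a') = (j₂ i).1 ((Sit₂ i).ι (LinearMap.proj a')))
    (hfr₃ : ∀ i a', ((thetaSpaceInputIn hHD hI h₁ h₃ S₀ hV).P 3).weilDatum.toThetaTop (φ₃ i a') = (j₃ i).1 ((Sit₃ i).ι (LinearMap.proj a')))
    (hΨ : Ψ = ∑ i, a i • (tau34 V c.D (φ₂ i 0) (φ₃ i 1) - tau34 V c.D (φ₂ i 1) (φ₃ i 0))) :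
    Ψ ∈ admWedgeSpan hHD hI h₁ h₃ S₀ hV := by
  rw [hΨ]
  exact Submodule.sum_mem _ fun i _ => Submodule.smul_mem _ _
    (wedge_mem_admWedgeSpan hHD hI h₁ h₃ S₀ hV (Γ' i) (Sit₂ i) (j₂ i) (Sit₃ i) (j₃ i) (φ₂ i) (φ₃ i) (hadm i) (hfr₂ i) (hfr₃ i))

end Generic

/-! ## 3. Pure tensors suffice -/

/-- A linear map out of a `PiTensorProduct` lands in a submodule as soon as it does on the pure tensors `⨂ₜ m`
(Mathlib `PiTensorProduct.span_tprod_eq_top`). -/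
theorem forall_mem_of_tprod_mem {ιb : Type*} [Fintype ιb] {M : ιb → Type*} [∀ b, AddCommGroup (M b)] [∀ b, Module ℂ (M b)]
    {X : Type*} [AddCommGroup X] [Module ℂ X] (T : (⨂[ℂ] b, M b) →ₗ[ℂ] X) (N : Submodule ℂ X)
    (h : ∀ m : ∀ b, M b, T (PiTensorProduct.tprod ℂ m) ∈ N) : ∀ φ, T φ ∈ N := by
  intro φ
  have hφ : φ ∈ Submodule.span ℂ (Set.range (PiTensorProduct.tprod ℂ : (∀ b, M b) → ⨂[ℂ] b, M b)) := by
    rw [PiTensorProduct.span_tprod_eq_top]; exact Submodule.mem_top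
  have hle : Submodule.span ℂ (Set.range (PiTensorProduct.tprod ℂ : (∀ b, M b) → ⨂[ℂ] b, M b)) ≤ N.comap T :=
    Submodule.span_le.2 (by rintro _ ⟨m, rfl⟩; exact h m)
  exact hle hφ

/-! ## 4. At the guarded pins: `Real34CensusSide` from span membership / from pure tensors -/

namespace Gen12PinsP

variable
  (G : ∀ {L : CMField} {ι₁ : L →+* ℂ} (_V : HermSpace3 L ι₁) (_c : SeesawCtx L), Prop)
  (hG : ∀ {L : CMField} {ι₁ : L →+* ℂ} (V : HermSpace3 L ι₁) (c : SeesawCtx L),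
    G V c → (∀ j, 0 < (ι₁ (dW c.D j)).re) ∨ ∀ j, (ι₁ (dW c.D j)).re < 0)
  (hGR : ∀ {L : CMField} {ι₁ : L →+* ℂ} (V : HermSpace3 L ι₁) (c : SeesawCtx L),
    (cmSplittingDatum (L : Type) finProdFinEquiv (frameD V) (frameD_real V) (frameD_ne V) (dW c.D) (dW_real c.D)
      (dW_ne c.D)).CompatibleSplitting)
  (η : ∀ {L : CMField} {ι₁ : L →+* ℂ} (V : HermSpace3 L ι₁) (c : SeesawCtx L),
    CMAdelic (L : Type) (frameD V) × CMAdelic (L : Type) (dW c.D) →* ℂˣ)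
  (hη : ∀ {L : CMField} {ι₁ : L →+* ℂ} (V : HermSpace3 L ι₁) (c : SeesawCtx L),
    ∀ γU ∈ CMRat (L : Type) (frameD V), ∀ γ ∈ CMRat (L : Type) (dW c.D), η V c (γU, γ) = 1)
  (hηc : ∀ {L : CMField} {ι₁ : L →+* ℂ} (V : HermSpace3 L ι₁) (c : SeesawCtx L), Continuous fun p => ((η V c p : ℂˣ) : ℂ))
  (hGR₀ : ∀ {L : CMField} {ι₁ : L →+* ℂ} (V : HermSpace3 L ι₁) (c : SeesawCtx L),
    (cmSplittingDatum (L : Type) (e₁) (frameD V) (frameD_real V) (frameD_ne V) (lineVec (L : Type) (dW c.D 0))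
      (fun _ => dW_real c.D 0) (fun _ => dW_ne c.D 0)).CompatibleSplitting)
  (hGR₁ : ∀ {L : CMField} {ι₁ : L →+* ℂ} (V : HermSpace3 L ι₁) (c : SeesawCtx L),
    (cmSplittingDatum (L : Type) (e₁) (frameD V) (frameD_real V) (frameD_ne V) (lineVec (L : Type) (dW c.D 1))
      (fun _ => dW_real c.D 1) (fun _ => dW_ne c.D 1)).CompatibleSplitting)
  (hGR₂ : ∀ {L : CMField} {ι₁ : L →+* ℂ} (V : HermSpace3 L ι₁) (c : SeesawCtx L),
    (cmSplittingDatum (L : Type) (e₁) (frameD V) (frameD_real V) (frameD_ne V) (lineVec (L : Type) (dW' c.D 0))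
      (fun _ => dW'_real c.D 0) (fun _ => dW'_ne c.D 0)).CompatibleSplitting)
  (hGR₃ : ∀ {L : CMField} {ι₁ : L →+* ℂ} (V : HermSpace3 L ι₁) (c : SeesawCtx L),
    (cmSplittingDatum (L : Type) (e₁) (frameD V) (frameD_real V) (frameD_ne V) (lineVec (L : Type) (dW' c.D 1))
      (fun _ => dW'_real c.D 1) (fun _ => dW'_ne c.D 1)).CompatibleSplitting)
  (AG : ∀ {L : CMField} {ι₁ : L →+* ℂ} (V : HermSpace3 L ι₁) (c : SeesawCtx L), G V c → ∀ k : Fin 4,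
    ArchLineInput V (lineRepD V c.D (hGR V c) (hGR₀ V c) (hGR₁ V c) (hGR₂ V c) (hGR₃ V c) (η V c) k))

variable (hHD : exists_isReal_hodgeModel) (hI : hodgePQ_independent_of_hodgeModel)
  (h₁ : BallQuotientUniformised)  (h₃ : CMAbelianVarietyRealised)
  (μ : ∀ {L : CMField}, SeesawCtx L → Fin 4 → InfinitePlace L → ℤ)

variable {L : CMField} {ι₁ : L →+* ℂ} (V : HermSpace3 L ι₁) (c : SeesawCtx L) (hV : IsAnisotropic L V.Hm)

/-- **Row 15's census side FROM SPAN MEMBERSHIP**: binder-2's (34) census core at the W pin plus `∀ f φ, core.side.ins f φ ∈ admWedgeSpan (S V c) hV`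
give `Real34CensusSide` (the `hwedge` field unpacked by § 2). -/
def Real34CensusSide.ofSpan
    (core : HypCoreW ((Gen12Pins.Wg @hGR @η @hη @hηc @Gen12Pins.τSyl @Gen12Pins.TSyl @Gen12Pins.hTSyl) V c) c.D.jT₃₄ (fun w => -μ c 2 w) (fun w => -μ c 3 w))
    (h : letI := core.decEq
      ∀ (f : core.side.FinIdx)
        (φ : (printPlaces (InfinitePlace (L : Type)) core.kind core.lam core.hlam (pinnedVacs core.kind (fun w => -μ c 2 w) (fun w => -μ c 3 w))).F),
        (core.side.ins f φ : piSchwartzBruhat (↥(maximalRealSubfield L)) (Fin 6)) ∈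
          admWedgeSpan hHD hI h₁ h₃ ((SInstance.SGP @G @hG @hGR @η @hη @hηc @hGR₀ @hGR₁ @hGR₂ @hGR₃ @AG) V c) hV) :
    Real34CensusSide @G @hG @hGR @η @hη @hηc @hGR₀ @hGR₁ @hGR₂ @hGR₃ @AG hHD hI h₁ h₃ @μ V c hV where
  core := core
  hwedge := fun f φ => exists_wedgeSum_of_mem_admWedgeSpan hHD hI h₁ h₃ _ hV (h f φ)

/-- **Row 15's census side FROM THE PURE TENSORS**: it suffices that every inserted printed PURE tensor `core.side.ins f (⨂ₜ m)` lies in the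
wedge span (§ 3: the printed archimedean module is `⨂[ℂ] b, (loc b).M`). -/
def Real34CensusSide.ofTprod
    (core : HypCoreW ((Gen12Pins.Wg @hGR @η @hη @hηc @Gen12Pins.τSyl @Gen12Pins.TSyl @Gen12Pins.hTSyl) V c) c.D.jT₃₄ (fun w => -μ c 2 w) (fun w => -μ c 3 w))
    (h : letI := core.decEq
      ∀ (f : core.side.FinIdx)
        (m : ∀ b : InfinitePlace (L : Type),
          ((printPlaces (InfinitePlace (L : Type)) core.kind core.lam core.hlam (pinnedVacs core.kind (fun w => -μ c 2 w) (fun w => -μ c 3 w))).loc b).M),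
        (core.side.ins f (PiTensorProduct.tprod ℂ m) : piSchwartzBruhat (↥(maximalRealSubfield L)) (Fin 6)) ∈
          admWedgeSpan hHD hI h₁ h₃ ((SInstance.SGP @G @hG @hGR @η @hη @hηc @hGR₀ @hGR₁ @hGR₂ @hGR₃ @AG) V c) hV) :
    Real34CensusSide @G @hG @hGR @η @hη @hηc @hGR₀ @hGR₁ @hGR₂ @hGR₃ @AG hHD hI h₁ h₃ @μ V c hV :=
  letI := core.decEq
  Real34CensusSide.ofSpan @G @hG @hGR @η @hη @hηc @hGR₀ @hGR₁ @hGR₂ @hGR₃ @AG hHD hI h₁ h₃ @μ V c hV core fun f =>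
    forall_mem_of_tprod_mem (core.side.ins f)
      (admWedgeSpan hHD hI h₁ h₃ ((SInstance.SGP @G @hG @hGR @η @hη @hηc @hGR₀ @hGR₁ @hGR₂ @hGR₃ @AG) V c) hV) (h f)

end Gen12PinsP

end HodgeCM.Model

end
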